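import Summits.Parity.GeneralizedHardyLittlewood.Theorems.GreenTaoLevelTwoGITwoCyclicInverseQuadMonomial

/-!
# Route `GreenTaoLevelTwo`, crux `GITwo` (stmt-Parity-21275), line `birth`, stub `stub_cyclicInverse`:
# tensor products with the product nilmanifold chosen BEFORE the data (uniformity in `N` for Thm. 68)

Seventy-seventh helper file toward the XL stub `stub_cyclicInverse` (B. Green, T. Tao, *An inverse
theorem for the Gowers `U³(G)` norm*, arXiv:math/0503014, Thm. 68 = PEMS 51 (2008) Thm. 12.8).
Block E17: the stub quantifies the finite family of nilmanifolds BEFORE `N` and `f`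
(`∃ m 𝓜 M c, … ∀ N f, ∃ i g x₀ h F, …`), so the product nilmanifold carrying the nilsequence of
arXiv Thm. 68 may depend on the number `d` of frequencies only ("an elementary 2-step nilsystem of
dimension `≤ η^{-C}`"), not on `N`, `f` or the frequencies.  The sibling lemmas
(`exists_tensor_pair`, `exists_tensor_family`, `exists_bracket_quad_monomial`, …) produce the
nilmanifold existentially AFTER the data; this def-free file re-proves them with the nilmanifold
fixed first:

* `exists_tensor_pair_on_prod` — the binary step with conclusion on the explicit `X.prod Y`;
* `exists_uniform_tensor_family` — for a fixed family `X : Fin k → Nilmanifold 2` of class members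
  there is ONE class member `Z` such that EVERY family of `1`-bounded Lipschitz `Φᵢ` on the `Xᵢ`
  (any `gᵢ, pᵢ, Mᵢ`) is tensored on `Z`;
* `exists_bracket_quad_monomial_on` — arXiv Lemma 69 (quadratic-xi) on the explicit nilmanifold
  `(𝕋 × 𝕋) × (H_d × H_d)`, for all `N, ξ, ξ', a` at once.

References: [GreenTao2008U3Inverse] arXiv:math/0503014, §12, Lemma 65, Lemma 69, Thm. 68.
-/

noncomputable section

namespace Summit.Parity.GeneralizedHardyLittlewood.GreenTaoLevelTwoGITwoCyclicInverse

open Literature.NumberTheory.Sieve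
open Literature.NumberTheory.Sieve.GreenTaoLevelTwo

/-- **Binary tensor step on the explicit product `X.prod Y`.** [cite: GreenTao2008U3Inverse, §12, Lemma 65] -/
theorem exists_tensor_pair_on_prod {X Y : Nilmanifold 2} {Φ₁ : X.G ⧸ X.Γ → ℂ} {Φ₂ : Y.G ⧸ Y.Γ → ℂ}
    (g₁ : X.G) (g₂ : Y.G) (p₁ : X.G ⧸ X.Γ) (p₂ : Y.G ⧸ Y.Γ) {M₁ M₂ : ℝ} (hM₁ : 0 ≤ M₁)
    (hM₂ : 0 ≤ M₂) (hb₁ : ∀ y, ‖Φ₁ y‖ ≤ 1) (hb₂ : ∀ y, ‖Φ₂ y‖ ≤ 1)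
    (hL₁ : ∀ y z, ‖Φ₁ y - Φ₁ z‖ ≤ M₁ * X.dist y z) (hL₂ : ∀ y z, ‖Φ₂ y - Φ₂ z‖ ≤ M₂ * Y.dist y z) :
    ∃ (Ψ : (X.prod Y).G ⧸ (X.prod Y).Γ → ℂ) (g : (X.prod Y).G) (p : (X.prod Y).G ⧸ (X.prod Y).Γ),
      (∀ y, ‖Ψ y‖ ≤ 1) ∧ (∀ y z, ‖Ψ y - Ψ z‖ ≤ (M₁ + M₂) * (X.prod Y).dist y z) ∧
      ∀ n : ℤ, Ψ (g ^ n • p) = Φ₁ (g₁ ^ n • p₁) * Φ₂ (g₂ ^ n • p₂) := by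
  obtain ⟨p₀, hp₀⟩ := exists_quotientProdMap_eq X Y p₁ p₂
  refine ⟨fun q => Φ₁ (Nilmanifold.quotientProdMap X Y q).1 * Φ₂ (Nilmanifold.quotientProdMap X Y q).2,
    ((g₁, g₂) : X.G × Y.G), p₀, fun q => norm_tensor_le_one hb₁ hb₂ q,
    fun q q' => norm_tensor_sub_tensor_le hM₁ hM₂ hb₁ hb₂ hL₁ hL₂ q q', fun n => ?_⟩
  have horb := quotientProdMap_zpow_smul X Y ((g₁, g₂) : X.G × Y.G) p₀ n
  show Φ₁ _ * Φ₂ _ = _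
  rw [horb, hp₀]

/-- **Uniform tensor family**: for fixed class members `X₀,…,X_{k−1}` there is ONE class member `Z`
on which every family of `1`-bounded `Mᵢ`-Lipschitz functions `Φᵢ` on the `Xᵢ`, with any `gᵢ, pᵢ`,
is realised as a tensor (`Ψ(gⁿp) = ∏ᵢ Φᵢ(gᵢⁿpᵢ)`, Lipschitz `∑ Mᵢ`).
[cite: GreenTao2008U3Inverse, §12, Lemma 65] -/
theorem exists_uniform_tensor_family (H : Nilmanifold 2) :
    ∀ (k : ℕ) (X : Fin k → Nilmanifold 2), (∀ i, InHeisClass H (X i)) →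
      ∃ Z : Nilmanifold 2, InHeisClass H Z ∧
        ∀ (Φ : ∀ i, (X i).G ⧸ (X i).Γ → ℂ) (g : ∀ i, (X i).G) (p : ∀ i, (X i).G ⧸ (X i).Γ)
          (M : Fin k → ℝ), (∀ i, 0 ≤ M i) → (∀ i y, ‖Φ i y‖ ≤ 1) →
          (∀ i y z, ‖Φ i y - Φ i z‖ ≤ M i * (X i).dist y z) →
          ∃ (Ψ : Z.G ⧸ Z.Γ → ℂ) (gZ : Z.G) (pZ : Z.G ⧸ Z.Γ),
            (∀ y, ‖Ψ y‖ ≤ 1) ∧ (∀ y z, ‖Ψ y - Ψ z‖ ≤ (∑ i, M i) * Z.dist y z) ∧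
            ∀ n : ℤ, Ψ (gZ ^ n • pZ) = ∏ i, Φ i (g i ^ n • p i) := by
  intro k
  induction k with
  | zero =>
    intro X _
    refine ⟨Nilmanifold.circle.ofLE (by norm_num : 1 ≤ 2), InHeisClass.circle, ?_⟩
    intro Φ g p M _ _ _
    refine ⟨fun _ => 1, 1,
      (QuotientGroup.mk (1 : Nilmanifold.circle.G) : Nilmanifold.circle.G ⧸ Nilmanifold.circle.Γ),
      fun _ => by simp, fun y z => ?_, fun n => ?_⟩
    · simp
    · simp
  | succ k ih =>
    intro X hX
    obtain ⟨Z, hZ, hZuniv⟩ := ih (fun i => X (Fin.castSucc i)) (fun i => hX _)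
    refine ⟨Z.prod (X (Fin.last k)), InHeisClass.prod hZ (hX (Fin.last k)), ?_⟩
    intro Φ g p M hM hb hL
    obtain ⟨Ψ, gZ, pZ, hΨb, hΨL, hΨorb⟩ := hZuniv (fun i => Φ (Fin.castSucc i))
      (fun i => g (Fin.castSucc i)) (fun i => p (Fin.castSucc i)) (fun i => M (Fin.castSucc i))
      (fun i => hM _) (fun i => hb _) (fun i => hL _)
    have hsum0 : 0 ≤ ∑ i : Fin k, M (Fin.castSucc i) := Finset.sum_nonneg fun i _ => hM _
    obtain ⟨Ψ', g', p', hb', hL', horb'⟩ := exists_tensor_pair_on_prod (X := Z) (Y := X (Fin.last k))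
      gZ (g (Fin.last k)) pZ (p (Fin.last k)) hsum0 (hM (Fin.last k)) hΨb (hb _) hΨL (hL _)
    refine ⟨Ψ', g', p', hb', fun y z => ?_, fun n => ?_⟩
    · rw [Fin.sum_univ_castSucc]; exact hL' y z
    · rw [horb' n, Fin.prod_univ_castSucc, hΨorb n]

/-- **arXiv Lemma 69 (quadratic-xi) on the explicit nilmanifold `(𝕋 × 𝕋) × (H_d × H_d)`**, for all
`N` (odd), `ξ, ξ'` and `a` at once (the data enter only `Ψ, g, p`).
[cite: GreenTao2008U3Inverse, §12, Lemma 69] -/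
theorem exists_bracket_quad_monomial_on (d : HX → HX → ℝ) (h : IsCompatMetric d) {L : ℝ}
    (hL : 0 ≤ L) (hcomp : ∀ p q, heisPreDist p q ≤ L * d p q ∧ d p q ≤ L * heisPreDist p q)
    {κ : AddCircle (1 : ℝ) → ℝ} {r₂ Lκ : ℝ} (hr : r₂ < 1 / 2) (hκ : ∀ a, 0 ≤ κ a ∧ κ a ≤ 1)
    (hκ0 : ∀ a, r₂ ≤ ‖a‖ → κ a = 0) (hκL : ∀ a b, |κ a - κ b| ≤ Lκ * dist a b) (hLκ : 0 ≤ Lκ)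
    {N : ℕ} [NeZero N] (hN : Odd N) (ξ ξ' : ZMod N) (a : ℝ) :
    let T : Nilmanifold 2 := (Nilmanifold.circle.ofLE (by norm_num : 1 ≤ 2)).prod
      (Nilmanifold.circle.ofLE (by norm_num : 1 ≤ 2))
    let Z : Nilmanifold 2 := T.prod ((heisenbergWith d h).prod (heisenbergWith d h))
    ∃ (Ψ : Z.G ⧸ Z.Γ → ℂ) (g : Z.G) (p : Z.G ⧸ Z.Γ),
      (∀ y, ‖Ψ y‖ ≤ 1) ∧
      (∀ y z, ‖Ψ y - Ψ z‖ ≤ (2 * (Lκ + 2 * Real.pi + 2 / (1 / 2 - r₂)) +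
          2 * ((4 * Real.pi + Lκ + 2 / (1 / 2 - r₂)) * L)) * Z.dist y z) ∧
      ∀ n : ℤ, Ψ (g ^ n • p) =
        ((κ (ZMod.toAddCircle ((n : ZMod N) * ξ)) : ℂ) * (κ (ZMod.toAddCircle ((n : ZMod N) * ξ')) : ℂ)) *
        (((κ (ZMod.toAddCircle ((n : ZMod N) * ξ)) : ℂ) * (κ (ZMod.toAddCircle ((n : ZMod N) * ξ')) : ℂ)) *
          ((AddCircle.toCircle (((a * ((((n : ZMod N) * ξ).valMinAbs : ℝ) / N) *
            ((((n : ZMod N) * ξ').valMinAbs : ℝ) / N) : ℝ)) : AddCircle (1 : ℝ)) : Circle) : ℂ)) := by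
  intro T Z
  -- split `a = q + s` and take the three factors (as in `exists_bracket_quad_monomial`)
  obtain ⟨q, s, has, hs⟩ := exists_int_add_small a
  set α : ℝ := (ξ.valMinAbs : ℝ) / N with hα
  set γ : ℝ := (ξ'.valMinAbs : ℝ) / N with hγ
  have hgap : 0 < 1 / 2 - r₂ := by linarith
  obtain ⟨Φ₁, g₁, p₁, hb₁, hL₁, horb₁⟩ := exists_quad_factor hr hκ hκ0 hκL hLκ ξ ξ' s
    (by norm_num : 1 ≤ 2)
  obtain ⟨Φ₂, g₂, p₂, hb₂, hL₂, horb₂⟩ := exists_heis_factor d h hcomp hr hκ hκ0 hκL hLκ ξ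
    (q * γ) (-(q * γ) / 2 + q * γ * α / 2) 0
  obtain ⟨Φ₃, g₃, p₃, hb₃, hL₃, horb₃⟩ := exists_heis_factor d h hcomp hr hκ hκ0 hκL hLκ ξ'
    (q * α) (-(q * α) / 2 + q * α * γ / 2) 0
  have hK₁ : 0 ≤ 2 * (Lκ + 2 * Real.pi * |s| + 2 / (1 / 2 - r₂)) := by positivity
  have hK₂ : 0 ≤ (4 * Real.pi + Lκ + 2 / (1 / 2 - r₂)) * L := by positivity
  have hK₁' : 2 * (Lκ + 2 * Real.pi * |s| + 2 / (1 / 2 - r₂)) ≤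
      2 * (Lκ + 2 * Real.pi + 2 / (1 / 2 - r₂)) := by
    have : 2 * Real.pi * |s| ≤ 2 * Real.pi := by nlinarith [Real.pi_pos, abs_nonneg s]
    linarith
  obtain ⟨Ψ₂₃, g₂₃, p₂₃, hb₂₃, hL₂₃, horb₂₃⟩ := exists_tensor_pair_on_prod
    (X := heisenbergWith d h) (Y := heisenbergWith d h) g₂ g₃ p₂ p₃ hK₂ hK₂ hb₂ hb₃ hL₂ hL₃
  obtain ⟨Ψ, g, p, hb, hLZ, horb⟩ := exists_tensor_pair_on_prod (X := T)
    (Y := (heisenbergWith d h).prod (heisenbergWith d h)) g₁ g₂₃ p₁ p₂₃ hK₁ (add_nonneg hK₂ hK₂)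
    hb₁ hb₂₃ hL₁ hL₂₃
  refine ⟨Ψ, g, p, hb, fun y z => (hLZ y z).trans ?_, fun n => ?_⟩
  · refine mul_le_mul_of_nonneg_right ?_ (Z.dist_nonneg y z)
    linarith
  · -- identical phase bookkeeping to `exists_bracket_quad_monomial`
    rw [horb n, horb₂₃ n, horb₁ n, horb₂ n, horb₃ n]
    set m : ℝ := ((((n : ZMod N) * ξ).valMinAbs : ℝ)) / N with hm
    set m' : ℝ := ((((n : ZMod N) * ξ').valMinAbs : ℝ)) / N with hm'
    have hmα : m = n * α - round ((n : ℝ) * α) := by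
      have e : (n : ZMod N) * ξ = (((n * ξ.valMinAbs : ℤ)) : ZMod N) := by
        rw [Int.cast_mul, ZMod.coe_valMinAbs]
      rw [hm, e, valMinAbs_div_eq hN, hα]
      push_cast
      rw [show (n : ℝ) * (ξ.valMinAbs : ℝ) / N = n * ((ξ.valMinAbs : ℝ) / N) by ring]
    have hmγ : m' = n * γ - round ((n : ℝ) * γ) := by
      have e : (n : ZMod N) * ξ' = (((n * ξ'.valMinAbs : ℤ)) : ZMod N) := by
        rw [Int.cast_mul, ZMod.coe_valMinAbs]
      rw [hm', e, valMinAbs_div_eq hN, hγ]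
      push_cast
      rw [show (n : ℝ) * (ξ'.valMinAbs : ℝ) / N = n * ((ξ'.valMinAbs : ℝ) / N) by ring]
    have key : ∀ u v : ℝ, u = v →
        ((AddCircle.toCircle ((u : ℝ) : AddCircle (1 : ℝ)) : Circle) : ℂ) =
          ((AddCircle.toCircle ((v : ℝ) : AddCircle (1 : ℝ)) : Circle) : ℂ) := fun u v huv => by rw [huv]
    have hsplit : ((AddCircle.toCircle (((a * m * m' : ℝ)) : AddCircle (1 : ℝ)) : Circle) : ℂ) =
        ((AddCircle.toCircle (((s * m * m' : ℝ)) : AddCircle (1 : ℝ)) : Circle) : ℂ) *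
          (((AddCircle.toCircle (((0 + n * (-(q * γ) / 2 + q * γ * α / 2 + q * γ / 2 - q * γ * α / 2) +
              (n : ℝ) ^ 2 * (q * γ * α / 2) - q * γ * n * round ((n : ℝ) * α) : ℝ)) :
                AddCircle (1 : ℝ)) : Circle) : ℂ) *
          ((AddCircle.toCircle (((0 + n * (-(q * α) / 2 + q * α * γ / 2 + q * α / 2 - q * α * γ / 2) +
              (n : ℝ) ^ 2 * (q * α * γ / 2) - q * α * n * round ((n : ℝ) * γ) : ℝ)) :
                AddCircle (1 : ℝ)) : Circle) : ℂ)) := by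
      have e1 : a * m * m' = s * m * m' + q * (n * α - round ((n : ℝ) * α)) *
          (n * γ - round ((n : ℝ) * γ)) := by rw [has, hmα, hmγ]; ring
      rw [e1, toCircle_coe_add_mul, toCircle_bracket_split,
        ← toCircle_coe_add_mul (0 + n * (-(q * γ) / 2 + q * γ * α / 2 + q * γ / 2 - q * γ * α / 2) +
              (n : ℝ) ^ 2 * (q * γ * α / 2) - q * γ * n * round ((n : ℝ) * α))]
      congr 1
      exact key _ _ (by ring)
    rw [hsplit]
    ring

end Summit.Parity.GeneralizedHardyLittlewood.GreenTaoLevelTwoGITwoCyclicInverse
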